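import Summits.BirchSwinnertonDyer.Rank1Residual.F1Sign2.TowerKummerAtlasAtTwo
import HarnessLib

/-!
# Cell `bsd-f1-sign2` — IMC-TK55 kernel: REF1 §190's BC7 edge lemmas for `F1Sign2/TowerKummerAtlasAtTwo.lean`

Typer -ty g17.  Source: REF1 g17's probe `HOME/REF1-data/b190/lean/Probe190.lean` **49e9b6b4c761ff7a** l.262–273 VERBATIM (namespace `…F1Sign2.REF1s190` of the probe
renamed to `…F1Sign2.TowerKummerAtlasAtTwo`; one-token typer fix `simp [sq]` → `simp` in `kummerImagesAgree_refl` — the farm lints the unused simp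
argument; the probe was farm-run by -ty on 2026-08-29: rc 0, 9 probe sorries — not ported — and these three sorry-free lemmas):
`layer_zero_iff` (layer 0 is `ℚ₂` itself: `IsCyclotomicLayerAtTwo 0 K ↔ finrank ℚ_[2] K = 1` — the iterate condition is vacuous), `kummerImagesAgree_refl`
(`KummerImagesAgree` is an INCLUSION statement, reflexive along `AlgHom.id`), `not_isOddClass_zero` (the `δ ≠ 0` guard of `IsOddClassAtTwo`); and REF1 g18 §192's
eight BC7 certificates for the layer-three block from `HOME/REF1-data/b192/lean/Probe192.lean` f3fc2078bb57f471 (farm rc 0, exactly 5 probe sorries — not ported):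
`octic_is_third_iterate` / `octic_is_iterate'` (the P57U/P57O octic IS `(x² − 2)^{∘3}`), `norm_valuation_nonneg_zero`, `inUnitFiltrationSq_sq` (every nonzero square is in
every `U^{(k)}K^{×2}`), `inUnitFiltrationSq_of_no_basis` (JUNK EDGE: with no finite `ℚ₂`-basis Mathlib's `Algebra.norm ℚ_[2]` is the junk constant `1` and
`InUnitFiltrationSqAtTwo c k δ` holds for EVERY `δ`, `c ≠ 0` — harmless under the laws' `finrank` / `IsCyclotomicLayerAtTwo` binders, never reuse the def without a
finiteness binder), `isTypeBlind_sq` / `isTypeBlind_one` (the trivial class is on the BLIND side of P57U, consistent with the fold), `inUnitFiltrationSq_zero_iff`.  and REF1 g18 §195's BC7 certificates for the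
layer-four block (D-imc-57 add58) from `HOME/REF1-data/b195/lean/Probe195.lean` 0e2bb122dd50d142 (farm rc 0, exactly 2 probe sorries — not ported), VERBATIM:
`isLeadingOddLevel_false_of_no_basis` / `isTypeBlindLevelAtLayerFour_of_no_basis` (junk polarity of the new carriers without a finite `ℚ₂`-basis), `isTypeBlindLevelAtLayerFour_sq`
(squares blind), `bc7_layer4_levels_partition` / `bc7_layer34_noClash` (`decide`), `bc7_conductor_same_layer` (`omega`), `bc7_layer4_poly` (the typed degree-16 polynomial IS the 4-fold
iterate of `x ↦ x² − 2`), `bc7_P58U_frame_is_layer4` (P58U's frame is `IsCyclotomicLayerAtTwo 4`); the three §192 lemmas Probe195 repeats are not duplicated.  ADD59 (-ty g18): -imc's five `decide` lemmas of `Sketch59.lean` 4cd694cf81b53af2 (`tie_levels_layer4/5`, `tie_iff_three_dvd_t` — the tie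
valuation `(4e+ℓ)/3 ∈ ℤ ⟺ ℓ ≡ 5 (mod 6)` at layer 4, `≡ 1 (mod 6)` at layer 5, `⟺ 3 ∣ f − 1`; `blindSet_matches_layers_2_to_5` — the observed blind odd levels of layers 2–5 are EXACTLY
those with `2e+1−ℓ ∈ {2,6,8,14,20,26}`; `doubledLevels_layer4` — the doubled formal levels `≤ 20` at `e = 16` are `{4,8,12,16,20}`) and REF1 g18 §200's certificates from
`HOME/REF1-data/b200/lean/Probe200.lean` 5c156619a4c6c199 (farm rc 0, exactly 5 probe sorries — not ported) VERBATIM: `bc7_cubicG_weierstrass` (`cubicGAtTwo` IS the long Weierstrass equation in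
`X = 4x`, `Y = 4(2y+a₁x+a₃)`), `bc7_blindSet_layers_0_1` (P59F at layers 0/1 = D-imc-54 THM B/C), `bc7_truncation` (the ℕ-subtraction junk of P59F is on the harmless side),
`bc7_dupNum_coords` / `bc7_dupDen_coords` (`X([2]P) = dupNum(X)/(4G(X))` is Silverman III.2.3(d)).  No new definition,
no new fact; proofs only, over the decls of `TowerKummerAtlasAtTwo.lean` (port of -imc g19's `Sketch57.lean` 3f58f222255131d0).  bears_on: stmt-BirchSwinnertonDyer-23715.
-/

noncomputable section

open WeierstrassCurve
open Summit.BirchSwinnertonDyer.Rank1Residual.F1Sign2.KummerField (algK kummerElt)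

namespace Summit.BirchSwinnertonDyer.Rank1Residual.F1Sign2.TowerKummerAtlasAtTwo

/-- BC7: layer 0 is `ℚ₂` itself: the iterate condition is vacuous (`id c = 0` has the witness `0`). -/
theorem layer_zero_iff (K : Type) [Field K] [Algebra ℚ_[2] K] :
    IsCyclotomicLayerAtTwo 0 K ↔ Module.finrank ℚ_[2] K = 1 := by
  unfold IsCyclotomicLayerAtTwo
  simp only [pow_zero, Function.iterate_zero, id_eq, exists_eq, and_true]
/-- BC7: `KummerImagesAgree` is an INCLUSION statement (`φ(Π₁) ⊆ Π₂`); it is reflexive along the identity map. -/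
theorem kummerImagesAgree_refl {K : Type} [Field K] (W' : WeierstrassCurve K) (P : W'.toAffine.Point) :
    ∃ P₂ : W'.toAffine.Point, IsSquare ((AlgHom.id K (algK W')) (kummerElt W' P) * kummerElt W' P₂) :=
  ⟨P, ⟨kummerElt W' P, by simp⟩⟩
/-- BC7: `IsOddClassAtTwo` excludes `0` explicitly and reads the valuation of the norm down to `ℚ₂`. -/
theorem not_isOddClass_zero {K : Type} [Field K] [Algebra ℚ_[2] K] : ¬ IsOddClassAtTwo (0 : K) := by
  simp [IsOddClassAtTwo]

/-! ## REF1 §192 (g18) BC7 certificates for the layer-three block (`Probe192.lean` f3fc2078bb57f471 l.347–404 verbatim; docstrings added by the typer on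
`octic_is_iterate'` and `isTypeBlind_one`, which had none) -/

/-- BC7: the octic of P57U/P57O is the third iterate of `x ↦ x² − 2` (so `c = 2cos(π/16)` and `K = ℚ₂(c) = ℚ_{2,3}`);
it is Eisenstein at 2 (coefficients −8, 20, −16 even, constant 2), hence `c` is a uniformiser. -/
theorem octic_is_third_iterate (x : ℤ) :
    ((x ^ 2 - 2) ^ 2 - 2) ^ 2 - 2 = x ^ 8 - 8 * x ^ 6 + 20 * x ^ 4 - 16 * x ^ 2 + 2 := by ring
/-- BC7 (REF1 §192): the same identity stated with `Function.iterate`. -/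
theorem octic_is_iterate' (x : ℤ) :
    (fun t : ℤ => t ^ 2 - 2)^[3] x = x ^ 8 - 8 * x ^ 6 + 20 * x ^ 4 - 16 * x ^ 2 + 2 := by
  simp only [Function.iterate_succ, Function.iterate_zero, Function.comp_apply, id_eq]
  ring
/-- BC7 (junk guard): the integrality clause `0 ≤ v₂(N_{K/ℚ₂} y)` holds at `y = 0` for EVERY `K` — when `K/ℚ₂` has a
finite basis `N 0 = 0` and `Padic.valuation 0 = 0`; when it has none Mathlib's `Algebra.norm` is the junk value `1`
(then the clause is `0 ≤ 0` for every `y`, and the def degenerates — harmless in P57U/P57O/P57L, whose `finrank`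
hypotheses force `Module.Finite`). -/
theorem norm_valuation_nonneg_zero {K : Type} [Field K] [Algebra ℚ_[2] K] :
    0 ≤ (Algebra.norm ℚ_[2] (0 : K)).valuation := by
  by_cases h : ∃ s : Finset K, Nonempty (Module.Basis s ℚ_[2] K)
  · obtain ⟨s, ⟨b⟩⟩ := h
    haveI : Module.Finite ℚ_[2] K := Module.Finite.of_basis b
    simp
  · rw [Algebra.norm_eq_one_of_not_exists_basis _ h]
    simp
/-- BC7: a nonzero square is in every level of the unit filtration (witness `y = 0`). -/
theorem inUnitFiltrationSq_sq {K : Type} [Field K] [Algebra ℚ_[2] K] (c : K) (k : ℕ) {x : K} (hx : x ≠ 0) :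
    InUnitFiltrationSqAtTwo c k (x ^ 2) :=
  ⟨x, 0, hx, norm_valuation_nonneg_zero, by ring⟩
/-- BC7 (junk edge): over a `K` with NO finite `ℚ₂`-basis the def is trivially true for every `δ` and every `c ≠ 0`
(take `x = 1`, `y = (δ − 1)/cᵏ`; the norm guard is the junk `0 ≤ v(1)`), so the def must only be used under a
`finrank`/`IsCyclotomicLayerAtTwo` binder — as Sketch57 does. -/
theorem inUnitFiltrationSq_of_no_basis {K : Type} [Field K] [Algebra ℚ_[2] K]
    (h : ¬ ∃ s : Finset K, Nonempty (Module.Basis s ℚ_[2] K)) (c : K) (hc : c ≠ 0) (k : ℕ) (δ : K) :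
    InUnitFiltrationSqAtTwo c k δ := by
  refine ⟨1, (δ - 1) / c ^ k, one_ne_zero, ?_, ?_⟩
  · rw [Algebra.norm_eq_one_of_not_exists_basis _ h]; simp
  · have : c ^ k ≠ 0 := pow_ne_zero k hc
    field_simp
    ring
/-- BC7: hence the trivial class `δ = 1` (and every square class, leading level `∞`) is on the BLIND side of P57U —
consistent with the fold (`[1]` blind at every layer). -/
theorem isTypeBlind_sq {K : Type} [Field K] [Algebra ℚ_[2] K] (c : K) {x : K} (hx : x ≠ 0) :
    IsTypeBlindLevelAtLayerThree c (x ^ 2) :=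
  Or.inr (Or.inr (inUnitFiltrationSq_sq c 15 hx))
/-- BC7 (REF1 §192): in particular the trivial class `δ = 1` is on the blind side of P57U. -/
theorem isTypeBlind_one {K : Type} [Field K] [Algebra ℚ_[2] K] (c : K) :
    IsTypeBlindLevelAtLayerThree c (1 : K) := by
  simpa using isTypeBlind_sq c (one_ne_zero (α := K))
/-- BC7: `InUnitFiltrationSqAtTwo` never holds for `δ = 0` (the `x ≠ 0` guard and `1 + cᵏ y` would have to vanish —
not excluded by the def itself, so the laws carry `δ ≠ 0` separately; here only the square factor is checked). -/
theorem inUnitFiltrationSq_zero_iff {K : Type} [Field K] [Algebra ℚ_[2] K] (c : K) (k : ℕ) :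
    InUnitFiltrationSqAtTwo c k 0 ↔ ∃ y : K, 0 ≤ (Algebra.norm ℚ_[2] y).valuation ∧ 1 + c ^ k * y = 0 := by
  constructor
  · rintro ⟨x, y, hx, hy, h⟩
    refine ⟨y, hy, ?_⟩
    have : x ^ 2 ≠ 0 := pow_ne_zero 2 hx
    rcases mul_eq_zero.mp h.symm with h1 | h1
    · exact absurd h1 this
    · exact h1
  · rintro ⟨y, hy, h⟩
    exact ⟨1, y, one_ne_zero, hy, by simp [h]⟩

/-! ## REF1 §195 (g18) BC7 certificates for the layer-four block (`Probe195.lean` 0e2bb122dd50d142 l.448–495 verbatim) -/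

/-- BC7-1 (junk edge of the NEW carrier, opposite polarity): without a finite basis NO class has a leading odd level — so in a junk
`K` the hypotheses `IsLeadingOddLevelAtTwo c ℓ δ` of P58V are unsatisfiable (P58V vacuously true there) while P58U is protected by its
`finrank = 16` binder.  Recorded, harmless: both Props bind a genuine layer. -/
theorem isLeadingOddLevel_false_of_no_basis {K : Type} [Field K] [Algebra ℚ_[2] K]
    (h : ¬ ∃ s : Finset K, Nonempty (Module.Basis s ℚ_[2] K)) (c : K) (hc : c ≠ 0) (ℓ : ℕ) (δ : K) :
    ¬ IsLeadingOddLevelAtTwo c ℓ δ :=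
  fun hL => hL.2.2 (inUnitFiltrationSq_of_no_basis h c hc (ℓ + 1) δ)

/-- BC7-2: in the same junk model every class is «blind at layer four» (last disjunct). -/
theorem isTypeBlindLevelAtLayerFour_of_no_basis {K : Type} [Field K] [Algebra ℚ_[2] K]
    (h : ¬ ∃ s : Finset K, Nonempty (Module.Basis s ℚ_[2] K)) (c : K) (hc : c ≠ 0) (δ : K) :
    IsTypeBlindLevelAtLayerFour c δ :=
  Or.inr (Or.inr (Or.inr (Or.inr (Or.inr (inUnitFiltrationSq_of_no_basis h c hc 31 δ)))))

/-- BC7-3: square classes (leading level `∞`, in particular `δ = 1`) are on the BLIND side of P58U — consistent with the fold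
(`[1]` blind at every layer) and with P55/P56/P57. -/
theorem isTypeBlindLevelAtLayerFour_sq {K : Type} [Field K] [Algebra ℚ_[2] K] (c : K) {x : K} (hx : x ≠ 0) :
    IsTypeBlindLevelAtLayerFour c (x ^ 2) :=
  Or.inr (Or.inr (Or.inr (Or.inr (Or.inr (inUnitFiltrationSq_sq c 31 hx)))))

/-- BC7-4 (level bookkeeping of P58U, `decide`): the blind odd levels `{7,13,19,25,27}` and the sensitive ones
`{1,3,5,9,11,15,17,21,23,29}` PARTITION the odd levels below `31` (level `31` and the level-`32` class sit in `U^{(31)}K^{×2}`, blind). -/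
theorem bc7_layer4_levels_partition :
    ∀ ℓ < 31, Odd ℓ → (ℓ ∈ ({7, 13, 19, 25, 27} : Finset ℕ) ↔ ℓ ∉ ({1, 3, 5, 9, 11, 15, 17, 21, 23, 29} : Finset ℕ)) := by
  decide

/-- BC7-5 (P58V's «no clash» between layers three and four, `decide` on the TYPED level sets): with `f = 2e + 1 − ℓ`, a layer-3 odd
level `ℓ₃ < 16` and the layer-4 level `ℓ₄ = ℓ₃ + 16` have the same conductor exponent, and the blind sets
`{3, 9, 11, 15}` (= the odd levels of `IsTypeBlindLevelAtLayerThree`) and `{7, 13, 19, 25, 27, 31}` (layer four) correspond exactly. -/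
theorem bc7_layer34_noClash :
    ∀ ℓ₃ < 16, Odd ℓ₃ → (ℓ₃ ∈ ({3, 9, 11, 15} : Finset ℕ) ↔ ℓ₃ + 16 ∈ ({7, 13, 19, 25, 27, 31} : Finset ℕ)) := by
  decide

/-- BC7-6: inside ONE layer (`n = n'`) P58V's conductor condition is `ℓ = ℓ'` — P58V restricted to a layer is the level law. -/
theorem bc7_conductor_same_layer (n ℓ ℓ' : ℕ) : 2 * 2 ^ n + ℓ' = 2 * 2 ^ n + ℓ ↔ ℓ = ℓ' := by
  omega

/-- BC7-7: the degree-16 polynomial typed in P58U IS the 4-fold iterate of `x ↦ x² − 2` used by `IsCyclotomicLayerAtTwo`. -/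
theorem bc7_layer4_poly {R : Type} [CommRing R] (c : R) :
    (fun x : R => x ^ 2 - 2)^[4] c =
      c ^ 16 - 16 * c ^ 14 + 104 * c ^ 12 - 352 * c ^ 10 + 660 * c ^ 8 - 672 * c ^ 6 + 336 * c ^ 4 - 64 * c ^ 2 + 2 := by
  simp only [Function.iterate_succ, Function.iterate_zero, Function.comp, id]
  ring

/-- BC7-8: hence P58U's frame `(finrank = 16, c a root of that polynomial)` is literally a model of `IsCyclotomicLayerAtTwo 4` —
P58U is P57-vocabulary at `n = 4`, and P58V at `(n, n') = (4, 4)` speaks about the same objects. -/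
theorem bc7_P58U_frame_is_layer4 {K : Type} [Field K] [Algebra ℚ_[2] K] (hK : Module.finrank ℚ_[2] K = 16) (c : K)
    (hc : c ^ 16 - 16 * c ^ 14 + 104 * c ^ 12 - 352 * c ^ 10 + 660 * c ^ 8 - 672 * c ^ 6 + 336 * c ^ 4 - 64 * c ^ 2 + 2 = 0) :
    IsCyclotomicLayerAtTwo 4 K :=
  ⟨by rw [hK]; norm_num, c, by rw [bc7_layer4_poly]; exact hc⟩

/-! ## ADD59 (-ty g18): -imc's `decide` bookkeeping lemmas of Sketch59 4cd694cf81b53af2 (D-imc-58 add3/add5) VERBATIM, and REF1 §200's carrier / truncation certificates from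
`Probe200.lean` 5c156619a4c6c199 l.160–181, l.436–449 VERBATIM (the three kernel refutations `P59B_false` / `P59W_false` / `P59D_false` concern the UN-repaired sketch bodies, which are not in the
tree, and are not ported; the `QuadraticAlgebra` layer-1 model needs an `instance` and is left in the probe). -/

/-- Kernel sanity: at layer 4 (`e = 16`) the tie valuation `(64 + ℓ)/3` is an integer for the odd levels `ℓ < 32` exactly when
`ℓ ≡ 5 (mod 6)` (the five levels engine 3 first missed), and at layer 5 (`e = 32`) exactly when `ℓ ≡ 1 (mod 6)`. -/
theorem tie_levels_layer4 : ∀ ℓ < 32, Odd ℓ → (3 ∣ 64 + ℓ ↔ ℓ % 6 = 5) := by decide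

/-- … and at layer 5 (`e = 32`) the tie valuation `(128 + ℓ)/3` is an integer for the odd levels `ℓ < 64` exactly when `ℓ ≡ 1 (mod 6)`. -/
theorem tie_levels_layer5 : ∀ ℓ < 64, Odd ℓ → (3 ∣ 128 + ℓ ↔ ℓ % 6 = 1) := by decide

/-- … and in conductor terms `f = 2e + 1 − ℓ`: `3 ∣ 4e + ℓ ↔ 3 ∣ f − 1` (both layers, all odd `ℓ < 2e`). -/
theorem tie_iff_three_dvd_t : (∀ ℓ < 32, Odd ℓ → (3 ∣ 64 + ℓ ↔ 3 ∣ 33 - ℓ - 1)) ∧ (∀ ℓ < 64, Odd ℓ → (3 ∣ 128 + ℓ ↔ 3 ∣ 65 - ℓ - 1)) := by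
  constructor <;> decide

/-- Kernel check of the census bookkeeping: the observed BLIND odd levels of layers 2–5 are exactly the levels whose conductor
`2e + 1 − ℓ` lies in `{2, 6, 8, 14, 20, 26}`. -/
theorem blindSet_matches_layers_2_to_5 :
    (∀ ℓ < 8, Odd ℓ → (9 - ℓ ∈ ({2, 6, 8, 14, 20, 26} : Finset ℕ) ↔ ℓ ∈ ({1, 3, 7} : Finset ℕ))) ∧
    (∀ ℓ < 16, Odd ℓ → (17 - ℓ ∈ ({2, 6, 8, 14, 20, 26} : Finset ℕ) ↔ ℓ ∈ ({3, 9, 11, 15} : Finset ℕ))) ∧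
    (∀ ℓ < 32, Odd ℓ → (33 - ℓ ∈ ({2, 6, 8, 14, 20, 26} : Finset ℕ) ↔ ℓ ∈ ({7, 13, 19, 25, 27, 31} : Finset ℕ))) ∧
    (∀ ℓ < 64, Odd ℓ → (65 - ℓ ∈ ({2, 6, 8, 14, 20, 26} : Finset ℕ) ↔ ℓ ∈ ({39, 45, 51, 57, 59, 63} : Finset ℕ))) := by
  refine ⟨?_, ?_, ?_, ?_⟩ <;> decide

/-- The doubled («killed») formal levels at layer 4 (`e = 16`) inside the engine window `m ≤ 20` are exactly `4, 8, 12, 16, 20`. -/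
theorem doubledLevels_layer4 : ∀ m ≤ 20, ((∃ j ≤ 20, m = 4 * j ∧ 0 < j ∧ 3 * j < 16) ∨ (∃ j ≤ 20, m = j + 16 ∧ 16 < 3 * j)) ↔ m ∈ [4, 8, 12, 16, 20] := by
  decide

/-- BC7 (carrier): `cubicGAtTwo` IS the long Weierstrass equation in the coordinates `X = 4x`, `Y = 4(2y + a₁x + a₃)`. -/
theorem bc7_cubicG_weierstrass {K : Type} [Field K] (a₁ a₂ a₃ a₄ a₆ : ℤ) (x y : K) :
    (4 * (2 * y + a₁ * x + a₃)) ^ 2 - cubicGAtTwo a₁ a₂ a₃ a₄ a₆ (4 * x)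
      = 64 * (y ^ 2 + a₁ * x * y + a₃ * y - (x ^ 3 + a₂ * x ^ 2 + a₄ * x + a₆)) := by
  unfold cubicGAtTwo; push_cast; ring

/-- BC7 (P59F bookkeeping, layers 0 and 1, complementing `blindSet_matches_layers_2_to_5`). -/
theorem bc7_blindSet_layers_0_1 :
    (∀ ℓ < 2, Odd ℓ → (3 - ℓ ∈ ({2, 6, 8, 14, 20, 26} : Finset ℕ) ↔ ℓ = 1)) ∧
    (∀ ℓ < 4, Odd ℓ → (5 - ℓ ∈ ({2, 6, 8, 14, 20, 26} : Finset ℕ) ↔ ℓ = 3)) := by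
  constructor <;> decide

/-- BC7 (P59F): beyond `ℓ = 2e − 1` the ℕ-subtraction `2·2ⁿ + 1 − ℓ` truncates to `0 ∉ S` or `1 ∉ S`, i.e. the typed RHS reads
«sensitive»; harmless because `IsLeadingOddLevelAtTwo c ℓ δ` is unsatisfiable there (U^{(2e+1)} ⊂ K^{×2}, REF1 §195). -/
theorem bc7_truncation (n ℓ : ℕ) (h : 2 * 2 ^ n + 1 ≤ ℓ + 1) :
    2 * 2 ^ n + 1 - ℓ ∉ ({2, 6, 8, 14, 20, 26} : Finset ℕ) := by
  have : 2 * 2 ^ n + 1 - ℓ ≤ 1 := by omega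
  intro hmem
  simp only [Finset.mem_insert, Finset.mem_singleton] at hmem
  omega

/-- BC7 (carrier): `dupNumAtTwo` IS `256·(x⁴ − b₄x² − 2b₆x − b₈)` at `X = 4x` (Silverman III.2.3(d) numerator of `x([2]P)`). -/
theorem bc7_dupNum_coords {K : Type} [Field K] (a₁ a₂ a₃ a₄ a₆ : ℤ) (x : K) :
    dupNumAtTwo a₁ a₂ a₃ a₄ a₆ (4 * x)
      = 256 * (x ^ 4 - (a₁ * a₃ + 2 * a₄ : K) * x ^ 2 - 2 * (a₃ ^ 2 + 4 * a₆ : K) * x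
          - (a₁ ^ 2 * a₆ + 4 * a₂ * a₆ - a₁ * a₃ * a₄ + a₂ * a₃ ^ 2 - a₄ ^ 2 : K)) := by
  unfold dupNumAtTwo; push_cast; ring

/-- BC7 (carrier): the denominator `4x³ + b₂x² + 2b₄x + b₆` of `x([2]P)` is `G(4x)/16`, so `X([2]P) = dupNum(X)/(4·G(X))`. -/
theorem bc7_dupDen_coords {K : Type} [Field K] [CharZero K] (a₁ a₂ a₃ a₄ a₆ : ℤ) (x : K) :
    16 * (4 * x ^ 3 + (a₁ ^ 2 + 4 * a₂ : K) * x ^ 2 + 2 * (a₁ * a₃ + 2 * a₄ : K) * x + (a₃ ^ 2 + 4 * a₆ : K))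
      = cubicGAtTwo a₁ a₂ a₃ a₄ a₆ (4 * x) := by
  unfold cubicGAtTwo; push_cast; ring

end Summit.BirchSwinnertonDyer.Rank1Residual.F1Sign2.TowerKummerAtlasAtTwo

end
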